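import Literature.GroupTheory.CombinatorialGroupTheory.QuadraticWordsForm
import Mathlib.LinearAlgebra.Matrix.ToLinearEquiv
import HarnessLib

/-!
# A balanced word with the value of the surface relator uses every symbol

Topic `Literature/GroupTheory/CombinatorialGroupTheory`.  A rank count behind the step
*"n″ = n"* of Zieschang's theorem on binary products with the value of the surface relator
(Zieschang–Vogt–Coldewey, *Surfaces and Planar Discontinuous Groups*, LNM 835 (1980),
Thm. 5.2.8: *"… then n′ = n"* — a binary product with fewer factors cannot have the value
`∏ [Tᵢ, Uᵢ]`), done with Zieschang's intersection form `ω` of `QuadraticWordsForm.lean`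
(ZVC 3.6, 5.5.1) instead of the cancellation analysis:

* `forall_exists_fst_eq_of_map_mk_eq_conj_surfaceWordStd` — if `ψ` is an endomorphism of the
  free group `F` on the `2g` symbols `a₀, b₀, …` and `L` is a balanced word with
  `ψ(L) = d · ∏ [aᵢ, bᵢ] · d⁻¹`, then EVERY symbol occurs in `L`.

Proof.  By naturality of the form on balanced words (`omega_map_mk_of_balanced`) and its
conjugation invariance, `ω_{ξ,η}(∏ [aᵢ,bᵢ]) = ω_{ψ^*ξ, ψ^*η}(L)` for all weights `ξ, η`, and
the right-hand side only involves the values of `ψ^*ξ` on the symbols of `L`.  If a symbol is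
missing, the `2g` weights `ξ` are subject to fewer than `2g` linear conditions
"`ψ^*ξ` vanishes on the symbols of `L`", so a nonzero such `ξ` exists (a square integer matrix
with a zero row is singular); for it the right-hand side vanishes for every `η`, contradicting
the nondegeneracy of the standard symplectic form `ω(∏ [aᵢ,bᵢ])` (`nondeg_surfaceWordStd`).

## References

* H. Zieschang, E. Vogt, H.-D. Coldewey, *Surfaces and Planar Discontinuous Groups*, LNM 835
  (1980), 3.6, Thm. 5.2.8, 5.5.1. [ZieschangVogtColdewey1980]
-/

namespace Literature.GroupTheory.CombinatorialGroupTheory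

open List

variable {ι : Type*} [DecidableEq ι] [Fintype ι]

/-- **The pull-back of weights is a matrix product**: `(ψ^*ξ) j = Σ_k (exponent sum of `x_k` in
`ψ x_j`) · ξ k`. [folklore] -/
theorem pull_eq_sum (ψ : FreeGroup ι →* FreeGroup ι) (ξ : ι → ℤ) (j : ι) :
    pull ψ ξ j = ∑ k, (((ψ (FreeGroup.of j)).toWord.count (k, true) : ℤ) -
      (ψ (FreeGroup.of j)).toWord.count (k, false)) * ξ k := by
  rw [pull, lsum_eq_sum_count]
  exact Finset.sum_congr rfl fun k _ => mul_comm _ _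

/-- **Fewer than all symbols impose too few conditions**: if some symbol `i` is not in the set
`S`, there is a nonzero weight `ξ` whose pull-back `ψ^*ξ` vanishes on `S`. [folklore] -/
theorem exists_ne_zero_pull_eq_zero (ψ : FreeGroup ι →* FreeGroup ι) (S : ι → Prop)
    [DecidablePred S] {i : ι} (hi : ¬ S i) :
    ∃ ξ : ι → ℤ, ξ ≠ 0 ∧ ∀ j, S j → pull ψ ξ j = 0 := by
  -- the square matrix of conditions, with the rows outside `S` zeroed
  set M : Matrix ι ι ℤ := fun j k => if S j then
    (((ψ (FreeGroup.of j)).toWord.count (k, true) : ℤ) - (ψ (FreeGroup.of j)).toWord.count (k, false))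
    else 0 with hM
  have hdet : M.det = 0 := Matrix.det_eq_zero_of_row_eq_zero i fun k => by simp [hM, hi]
  obtain ⟨v, hv, hMv⟩ := Matrix.exists_mulVec_eq_zero_iff.2 hdet
  refine ⟨v, hv, fun j hj => ?_⟩
  have h := congrFun hMv j
  rw [Matrix.mulVec, Pi.zero_apply] at h
  change (∑ k, M j k * v k) = 0 at h
  rw [pull_eq_sum]
  simpa [hM, hj] using h

/-- **A balanced word with the value of the surface relator (up to conjugation, under an
endomorphism) uses every symbol** (ZVC Thm. 5.2.8: *"n′ = n"*).
[cite: ZieschangVogtColdewey1980, Thm. 5.2.8] -/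
theorem forall_exists_fst_eq_of_map_mk_eq_conj_surfaceWordStd {g : ℕ}
    (L : List ((Fin g × Bool) × Bool)) (hL : IsBalanced L)
    (ψ : FreeGroup (Fin g × Bool) →* FreeGroup (Fin g × Bool)) (d : FreeGroup (Fin g × Bool))
    (h : ψ (FreeGroup.mk L) = d * FreeGroup.mk (surfaceWordStd g) * d⁻¹) (i : Fin g × Bool) :
    ∃ x ∈ L, x.1 = i := by
  by_contra hi
  push Not at hi
  obtain ⟨ξ, hξ, hS⟩ := exists_ne_zero_pull_eq_zero ψ (fun j => ∃ x ∈ L, x.1 = j)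
    (i := i) (fun ⟨x, hx, hxi⟩ => hi x hx hxi)
  obtain ⟨η, hη⟩ := nondeg_surfaceWordStd g ξ hξ
  apply hη
  -- `ω_{ξ,η}(∏[aᵢ,bᵢ]) = ω_{ξ,η}(d ∏[aᵢ,bᵢ] d⁻¹) = ω_{ξ,η}(ψ L) = ω_{ψ^*ξ,ψ^*η}(L) = 0`
  have hbal : IsBalanced (surfaceWordStd g) := (isQuadratic_surfaceWordStd g).isBalanced
  have e1 : omega ξ η (FreeGroup.mk (surfaceWordStd g)) = omega ξ η (ψ (FreeGroup.mk L)) := by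
    rw [h]
    have := omega_conj_map_mk_of_balanced ξ η (MonoidHom.id _) d hbal
    simpa using this.symm
  rw [e1, omega_map_mk_of_balanced ξ η ψ hL, omega_mk]
  exact omegaW_eq_zero_of_forall fun x hx => hS x.1 ⟨x, hx, rfl⟩

end Literature.GroupTheory.CombinatorialGroupTheory
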